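import Summits.QuantumFields.BalabanUV.Beta.SymAveragingWardRooted
import Summits.QuantumFields.BalabanUV.Beta.SymAveragingHessianCounts
import Summits.QuantumFields.BalabanUV.Beta.AveragingWardRootedStencils
import Summits.QuantumFields.BalabanUV.Beta.DshAn1Spread

/-!
# (K-V2)sym and the (0.4) stencil Ward law (S-V)⁰⁴ for the symmetrised table `symVhSAt` (node 8ρ-sym, stencil leaf)

[folklore] Kinematics only; the (0.4)-twin of `AveragingWardRooted` §3/§4 and `AveragingWardRootedStencils` §1/§3/§4 for
an1's SYMMETRISED functionals and the field–multiplier table `SymAveragingHessianCounts.symVhSAt ρ d L` (the TYPE of the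
field `V` of `SymmetrisedStepJets.SymTables`):
* §W the four Ward identities `symSkewHessAt_grad_left/right`, `symSkewVHAt_grad_left/right` of the generic functionals of
  `SymAveragingWardRooted` — node 8ρ's shape with the weights `d!` resp. `2·d!·L^d` (only the root `r = L·y + ρ` and
  `r + L·e_μ` survive) — and the bridges `symHessCountAt ρ = symSkewHessAt (·*·) ρ δ δ`, `symVhCountAt ρ = symSkewVHAt (·*·) ρ δ δ`
  (namespace `SymAveragingWardRooted`);
* §1 (K-V2)sym `symVhCountAt_div_right` / `symVhKerAt_div_right`: the backward divergence of the product-chart kernel in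
  its BACKGROUND bond is the contact `([r = z] − [f₋ = z]) · q¹,ρ_sym(f)` AT THE ROOT `r = L·y + ρ` (from the Ward identity
  `SymAveragingWardRooted.symSkewVHAt_grad_right`);
* §2 the (0.4) packed first-order kernel of record `DshAn1.linSym04At ρ L` has the entries `q¹,ρ_sym = symLinKerAt ρ`
  (`lin04KerAt_eq_symLinKerAt`, by gen 41's bridge `symLinKerAt_eq_symLinAvgAt`);
* §3 the four colour blocks of `divV (symVhSAt ρ d L) u`;
* §4 **(S-V)⁰⁴** `divV_symVhSAt_eq_conjV : divV (symVhSAt ρ d L) u = conjV (mfNeg (linSym04At ρ L)) (diagK (legInd ρ u))`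
  and its centred-root instance `divV_symVhSAt_eq_conjV_ctr` — LITERALLY the letter `hVd04` of the root END
  `RowD1JointEndSymWard.d1Drift_JsB12Sym_of_an1Shift_wardTables_reflLetters_D1Tel_D1Rep` for the instance
  `tabs.V := symVhSAt (ctr (d+1) Lc) d Lc` (there `d = 3`), now a THEOREM (needs only `1 ≤ Lc`).

WHAT IS NOT PROVED / NOT CLAIMED: nothing printed ([Balaban1987RG1] (0.4) is a locator); the other Ward/table letters of
that END (`hc1`, `hSp`, `hMp`, the (T2-B)/(T2-M₂) tables, `hWil`) are NOT touched here; nothing about logarithms, `wilsonA`,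
`KInv`, (W1′)/(W2′), the socket, (R1), (K1·), `BetaPertH`, continuum, Clay.

Provenance: cell pub-balaban, β sub-cell, lineage an1, gen 42 (2026-08-21); over `SymAveragingWardRooted` (this gen),
an1 gen 41's `SymAveragingHessianCounts` (kernels, `symVhSAt`, BY NAME), node 8ρ's `AveragingWardRootedStencils` (`legInd`,
BY NAME), an2's `KernelWard.divV` / `ChartConjugation.conjV` / `BorderedHessian.diagK` and an1 g3x's `DshAn1.linSym04At`
(BY NAME); proofs transcribed from node 8ρ; no existing file touched.  Bib keys (locators only): Balaban1985Averaging,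
Balaban1987RG1.
-/

open Finset
open scoped BigOperators Nat
open Literature.MathematicalPhysics.QuantumFieldTheory.Balaban1983to89
open Literature.MathematicalPhysics.QuantumFieldTheory.Balaban1983to89.Beta
open AffineAveraging AveragingContours TransportedContourVariables AveragingHessianKernels AveragingWardJets
  AveragingContoursRooted AveragingHessianKernelsRooted
open Summit.QuantumFields.BalabanUV.Beta.SymAveragingHessianCounts
open Summit.QuantumFields.BalabanUV.Beta.SymAveragingWardRooted

namespace Summit.QuantumFields.BalabanUV.Beta.SymAveragingWardRooted

/-! ## §W The four Ward identities of the symmetrised functionals (namespace `SymAveragingWardRooted`) -/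

section Ward

variable {d : ℕ} {A V : Type*} [AddCommGroup A] [AddCommGroup V] (β : A →+ A →+ V)

/-- [folklore] **WARD IDENTITY FOR `symSkewHessAt β ρ`, LEFT SLOT.**  For an exact first form `grad λ` only the
GENERIC LINEAR functional survives, at the endpoints of the coarse bond from the root, with the weight `d!`:
`symSkewHessAt β ρ (grad λ) B = d! • (S (midF β λ B) − β (λ r + λ (r + L e_μ)) (S B))`, `r = L·y + ρ`. -/
theorem symSkewHessAt_grad_left (ρ : Fin d → ℤ) (lam : (Fin d → ℤ) → A) (B : Form1 d A) (L : ℕ) (μ : Fin d)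
    (y : Fin d → ℤ) :
    symSkewHessAt β ρ (grad lam) B L μ y
      = (d ! : ℤ) • (symZ ρ (midF β lam B) L μ y
          - β (lam ((L : ℤ) • y + ρ) + lam ((L : ℤ) • y + ρ + (L : ℤ) • unitVec μ)) (symZ ρ B L μ y)) := by
  have hβsum : ∀ (c : A) (g : (Fin d → ℕ) → Equiv.Perm (Fin d) → Equiv.Perm (Fin d) → A),
      (∑ b ∈ box d L, ∑ σ : Equiv.Perm (Fin d), ∑ σ' : Equiv.Perm (Fin d), β c (g b σ σ'))
        = β c (∑ b ∈ box d L, ∑ σ : Equiv.Perm (Fin d), ∑ σ' : Equiv.Perm (Fin d), g b σ σ') := by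
    intro c g; simp only [map_sum]
  simp only [symSkewHessAt, skew_loopPAt_grad, skew_segUp_grad, Finset.sum_sub_distrib, Finset.sum_add_distrib, hβsum,
    sum_pair_loopPAt_sum, symZ_grad, segUp_sum_grad, map_add, map_sub, map_zsmul, AddMonoidHom.add_apply,
    AddMonoidHom.sub_apply, AddMonoidHom.zsmul_apply, smul_add, smul_sub]
  module

/-- [folklore] **WARD IDENTITY FOR `symSkewHessAt β ρ`, RIGHT SLOT.** -/
theorem symSkewHessAt_grad_right (ρ : Fin d → ℤ) (X : Form1 d A) (lam : (Fin d → ℤ) → A) (L : ℕ) (μ : Fin d)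
    (y : Fin d → ℤ) :
    symSkewHessAt β ρ X (grad lam) L μ y
      = (d ! : ℤ) • (β (symZ ρ X L μ y) (lam ((L : ℤ) • y + ρ) + lam ((L : ℤ) • y + ρ + (L : ℤ) • unitVec μ))
          - symZ ρ (midF β.flip lam X) L μ y) := by
  rw [symSkewHessAt_swap β, symSkewHessAt_grad_left, AddMonoidHom.flip_apply, smul_sub, smul_sub, neg_sub]

/-- [folklore] **WARD IDENTITY FOR `symSkewVHAt β ρ`, LEFT SLOT**: only the far endpoint `r + L e_μ` survives,
`symSkewVHAt β ρ (grad λ) B = (2·d!·L^d) • (S (endF β λ B) − β (λ (r + L e_μ)) (S B))`. -/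
theorem symSkewVHAt_grad_left (ρ : Fin d → ℤ) (lam : (Fin d → ℤ) → A) (B : Form1 d A) (L : ℕ) (μ : Fin d)
    (y : Fin d → ℤ) :
    symSkewVHAt β ρ (grad lam) B L μ y
      = (2 * (d ! : ℤ) * (L : ℤ) ^ d) • (symZ ρ (endF β lam B) L μ y
          - β (lam ((L : ℤ) • y + ρ + (L : ℤ) • unitVec μ)) (symZ ρ B L μ y)) := by
  have hform : ptF β (grad lam) B = endF β lam B + endF β lam B - midF β lam B := by
    funext κ x
    simp only [ptF_apply, endF_apply, midF_apply, grad, Pi.add_apply, Pi.sub_apply, map_add, map_sub,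
      AddMonoidHom.add_apply, AddMonoidHom.sub_apply]
    abel
  rw [symSkewVHAt, symSkewHessAt_grad_left, hform, symZ_sub, symZ_addForm, symZ_grad]
  simp only [map_add, map_sub, map_zsmul, AddMonoidHom.add_apply, AddMonoidHom.sub_apply, AddMonoidHom.zsmul_apply,
    smul_add, smul_sub]
  module

/-- [folklore] **WARD IDENTITY FOR `symSkewVHAt β ρ`, RIGHT SLOT**: only the ROOT `r` survives,
`symSkewVHAt β ρ X (grad λ) = (2·d!·L^d) • (β (S X) (λ r) − S (iniF β X λ))`. -/
theorem symSkewVHAt_grad_right (ρ : Fin d → ℤ) (X : Form1 d A) (lam : (Fin d → ℤ) → A) (L : ℕ) (μ : Fin d)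
    (y : Fin d → ℤ) :
    symSkewVHAt β ρ X (grad lam) L μ y
      = (2 * (d ! : ℤ) * (L : ℤ) ^ d) • (β (symZ ρ X L μ y) (lam ((L : ℤ) • y + ρ)) - symZ ρ (iniF β X lam) L μ y) := by
  have hform : ptF β X (grad lam) = midF β.flip lam X - (iniF β X lam + iniF β X lam) := by
    funext κ x
    simp only [ptF_apply, iniF_apply, midF_apply, grad, Pi.add_apply, Pi.sub_apply, map_add, map_sub,
      AddMonoidHom.add_apply, AddMonoidHom.flip_apply]
    abel
  rw [symSkewVHAt, symSkewHessAt_grad_right, hform, symZ_sub, symZ_addForm, symZ_grad]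
  simp only [map_add, map_sub, map_zsmul, smul_add, smul_sub]
  module

end Ward

/-! ## §W′ Bridges to the (0.4) counts -/

section Bridge

variable {d : ℕ}

/-- [folklore] `S(single f w) = symLinCountAt f • w` for the generic functional on a ring. -/
theorem symZ_single {𝔸 : Type*} [Ring 𝔸] (ρ : Fin d → ℤ) (f : Bond d) (w : 𝔸) (L : ℕ) (μ : Fin d) (y : Fin d → ℤ) :
    symZ ρ (single f w) L μ y = symLinCountAt ρ L μ y f • w :=
  symLinU_single ρ f w L μ y

/-- [folklore] `S(δ_f) = symLinCountAt f` (`rfl`). -/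
theorem symZ_δ1 (ρ : Fin d → ℤ) (f : Bond d) (L : ℕ) (μ : Fin d) (y : Fin d → ℤ) :
    symZ ρ (δ1 f) L μ y = symLinCountAt ρ L μ y f := rfl

/-- [folklore] BRIDGE: `symHessCountAt ρ f f′ = symSkewHessAt (·*·) ρ δ_f δ_{f′}` (on the commutative ring `ℤ`). -/
theorem symHessCountAt_eq_symSkewHessAt (ρ : Fin d → ℤ) (L : ℕ) (μ : Fin d) (y : Fin d → ℤ) (f f' : Bond d) :
    symHessCountAt ρ L μ y f f' = symSkewHessAt mulZ ρ (δ1 f) (δ1 f') L μ y := by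
  simp only [symHessCountAt, symWedgeCountAt, symSkewHessAt, symLinCountAt, symLinU, symZ, cCountAt, wedge_eq_skew, mulZ,
    AddMonoidHom.mul_apply, smul_eq_mul]
  ring

/-- [folklore] BRIDGE: `symVhCountAt ρ f f′ = symSkewVHAt (·*·) ρ δ_f δ_{f′}`. -/
theorem symVhCountAt_eq_symSkewVHAt (ρ : Fin d → ℤ) (L : ℕ) (μ : Fin d) (y : Fin d → ℤ) (f f' : Bond d) :
    symVhCountAt ρ L μ y f f' = symSkewVHAt mulZ ρ (δ1 f) (δ1 f') L μ y := by
  have hpt : symZ ρ (ptF mulZ (δ1 f) (δ1 f')) L μ y = if f = f' then symLinCountAt ρ L μ y f else 0 := by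
    rw [ptF_mulZ_δ1]
    split_ifs with h
    · rfl
    · exact symZ_zeroForm ρ L μ y
  rw [symVhCountAt, symSkewVHAt, hpt, symHessCountAt_eq_symSkewHessAt, symZ_δ1, symZ_δ1, AddMonoidHom.mul_apply, smul_eq_mul,
    smul_eq_mul]
  split_ifs <;> ring

end Bridge

end Summit.QuantumFields.BalabanUV.Beta.SymAveragingWardRooted

namespace Summit.QuantumFields.BalabanUV.Beta.SymAveragingWardRootedStencils

/-! ## §1 (K-V2)sym, letter / kernel flavour -/

section Kernel

variable {d : ℕ}

/-- [folklore] **(K-V2)sym BACKWARD-DIVERGENCE LAW OF THE SYMMETRISED PRODUCT-CHART COUNT in its BACKGROUND bond**: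
`Σ_κ (symVhCountAt ρ f (κ, z − e_κ) − symVhCountAt ρ f (κ, z)) = 2·d!·L^d · ([r = z] − [f₋ = z]) · symLinCountAt ρ f` —
THE CONTACT SITS AT THE ROOT `r = L·y + ρ`. -/
theorem symVhCountAt_div_right (ρ : Fin d → ℤ) (L : ℕ) (μ : Fin d) (y : Fin d → ℤ) (f : Bond d) (z : Fin d → ℤ) :
    ∑ κ : Fin d, (symVhCountAt ρ L μ y f (κ, z - unitVec κ) - symVhCountAt ρ L μ y f (κ, z))
      = 2 * (d ! : ℤ) * (L : ℤ) ^ d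
        * (((if (L : ℤ) • y + ρ = z then 1 else 0) - (if f.2 = z then 1 else 0)) * symLinCountAt ρ L μ y f) := by
  simp only [symVhCountAt_eq_symSkewVHAt, ← symSkewVHAt_sub_right, ← symSkewVHAt_sum_right, ← grad_siteδ,
    symSkewVHAt_grad_right, iniF_mulZ_siteδ, symZ_single, symZ_δ1, siteδ_apply, AddMonoidHom.mul_apply, smul_eq_mul]
  ring

/-- [folklore] **(K-V2)sym for the REAL symmetrised kernel**: divergence in the background bond
`= ([r = z] − [f₋ = z]) · q¹,ρ_sym(f)`, `r = L·y + ρ` THE ROOT. -/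
theorem symVhKerAt_div_right {L : ℕ} (hL : 1 ≤ L) (ρ : Fin d → ℤ) (μ : Fin d) (y : Fin d → ℤ) (f : Bond d)
    (z : Fin d → ℤ) :
    ∑ κ : Fin d, (symVhKerAt ρ L μ y f (κ, z - unitVec κ) - symVhKerAt ρ L μ y f (κ, z))
      = ((if (L : ℤ) • y + ρ = z then 1 else 0) - (if f.2 = z then 1 else 0)) * symLinKerAt ρ L μ y f := by
  have hL' : (L : ℝ) ≠ 0 := by exact_mod_cast (show L ≠ 0 by omega)
  have hd : (d ! : ℝ) ≠ 0 := by exact_mod_cast (Nat.factorial_ne_zero d)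
  simp only [symVhKerAt, symLinKerAt, ← sub_div, ← Finset.sum_div, ← Int.cast_sub, ← Int.cast_sum, symVhCountAt_div_right]
  push_cast
  field_simp
  ring

end Kernel

/-! ## §2 The entries of the (0.4) packed first-order kernel of record -/

noncomputable section

open Literature.MathematicalPhysics.QuantumFieldTheory.Balaban1983to89.Beta.ExpKernelCalculus (MKer comp)
open Literature.MathematicalPhysics.QuantumFieldTheory.Balaban1983to89.Beta.OneStepResolventKernel (Fib)
open Literature.MathematicalPhysics.QuantumFieldTheory.Balaban1983to89.Beta.StepJetData (mfNeg mfNeg_inl_inl mfNeg_inl_inr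
  mfNeg_inr_inl mfNeg_inr_inr)
open Literature.MathematicalPhysics.QuantumFieldTheory.Balaban1983to89.Beta.KernelWard (divV)
open Literature.MathematicalPhysics.QuantumFieldTheory.Balaban1983to89.Beta.AveragingWardStencils (b6UnitVec_eq)
open Summit.QuantumFields.BalabanUV.Beta.ChartConjugation (conjV)
open Summit.QuantumFields.BalabanUV.Beta.BorderedHessian (diagK diagK_apply conjV_diagK_apply)
open Summit.QuantumFields.BalabanUV.Beta.AveragingWardRootedStencils (legInd legInd_inl legInd_inr legInd_apply legSite)
open Summit.QuantumFields.BalabanUV.Beta.DshAn1 (lin04KerAt linSym04At linSym04At_inl_inr linSym04At_inr_inl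
  linSym04At_inl_inl linSym04At_inr_inr)

variable {d : ℕ}

/-- [folklore] **THE (0.4) LINEAR KERNEL OF RECORD IS gen 41's `symLinKerAt`** (dimension `d + 1`):
`DshAn1.lin04KerAt ρ L μ B f = symLinKerAt ρ L μ B f` (gen 41's bridge `symLinKerAt_eq_symLinAvgAt`; `delta1` unfolds by `rfl`). -/
theorem lin04KerAt_eq_symLinKerAt (ρ : Fin (d + 1) → ℤ) (L : ℕ) (μ : Fin (d + 1)) (B : Fin (d + 1) → ℤ)
    (f : Fin (d + 1) × (Fin (d + 1) → ℤ)) : lin04KerAt ρ L μ B f = symLinKerAt ρ L μ B f := by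
  rw [symLinKerAt_eq_symLinAvgAt]; rfl

/-! ## §3 The four colour blocks of `divV (symVhSAt ρ d L) u` -/

/-- [folklore] **THE `(inl, inr)` BLOCK**: for the fluctuation leg `(α, x)` and the multiplier leg `(μ, z)`,
`Σ_κ′ (symVhSAt ρ κ′ (u − e_κ′) − symVhSAt ρ κ′ u)((x, inl α), (z, inr μ)) = ([z + ρ = u] − [x = u]) · q¹,ρ_sym` —
(K-V2)sym read through node 7a's packer (on its support `z = L • blk L z`). -/
theorem divV_symVhSAt_inl_inr {L : ℕ} (hL : 1 ≤ L) (ρ u x z : Fin (d + 1) → ℤ) (α μ : Fin (d + 1)) :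
    divV (symVhSAt ρ d L) u x z (Sum.inl α) (Sum.inr μ)
      = ((if z + ρ = u then 1 else 0) - (if x = u then 1 else 0)) * linSym04At ρ L x z (Sum.inl α) (Sum.inr μ) := by
  simp only [KernelWard.divV, Finset.sum_apply, Pi.sub_apply, symVhSAt, packVH_inl_inr, linSym04At_inl_inr,
    lin04KerAt_eq_symLinKerAt]
  by_cases hz : off L z = 0
  · simp only [hz, if_true, b6UnitVec_eq]
    rw [symVhKerAt_div_right hL, ← eq_smul_blk_of_off_eq_zero hL hz]
  · simp [hz]

/-- [folklore] **THE `(inr, inl)` BLOCK** (the packer's symmetric twin; legs exchanged, hence the opposite sign). -/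
theorem divV_symVhSAt_inr_inl {L : ℕ} (hL : 1 ≤ L) (ρ u x z : Fin (d + 1) → ℤ) (μ α : Fin (d + 1)) :
    divV (symVhSAt ρ d L) u x z (Sum.inr μ) (Sum.inl α)
      = ((if x + ρ = u then 1 else 0) - (if z = u then 1 else 0)) * linSym04At ρ L x z (Sum.inr μ) (Sum.inl α) := by
  simp only [KernelWard.divV, Finset.sum_apply, Pi.sub_apply, symVhSAt, packVH_inr_inl, linSym04At_inr_inl,
    lin04KerAt_eq_symLinKerAt]
  by_cases hx : off L x = 0
  · simp only [hx, if_true, b6UnitVec_eq]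
    rw [symVhKerAt_div_right hL, ← eq_smul_blk_of_off_eq_zero hL hx]
  · simp [hx]

/-- [folklore] The divergence vanishes on the field–field block. -/
theorem divV_symVhSAt_inl_inl (ρ : Fin (d + 1) → ℤ) (L : ℕ) (u x z : Fin (d + 1) → ℤ) (α α' : Fin (d + 1)) :
    divV (symVhSAt ρ d L) u x z (Sum.inl α) (Sum.inl α') = 0 := by
  simp [KernelWard.divV, Finset.sum_apply, symVhSAt]

/-- [folklore] The divergence vanishes on the multiplier–multiplier block. -/
theorem divV_symVhSAt_inr_inr (ρ : Fin (d + 1) → ℤ) (L : ℕ) (u x z : Fin (d + 1) → ℤ) (μ μ' : Fin (d + 1)) :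
    divV (symVhSAt ρ d L) u x z (Sum.inr μ) (Sum.inr μ') = 0 := by
  simp [KernelWard.divV, Finset.sum_apply, symVhSAt]

/-! ## §4 (S-V)⁰⁴ The stencil Ward law of the symmetrised table, entrywise and as a commutator -/

/-- [folklore] **(S-V)⁰⁴ ENTRYWISE**: `divV (symVhSAt ρ d L) u x z a b = (legInd ρ u z b − legInd ρ u x a) · mfNeg (linSym04At ρ L) x z a b`. -/
theorem divV_symVhSAt_apply {L : ℕ} (hL : 1 ≤ L) (ρ u x z : Fin (d + 1) → ℤ) (a b : Fib d) :
    divV (symVhSAt ρ d L) u x z a b = (legInd ρ u z b - legInd ρ u x a) * mfNeg (linSym04At ρ L) x z a b := by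
  rcases a with α | μ <;> rcases b with α' | μ'
  · simp [divV_symVhSAt_inl_inl]
  · rw [mfNeg_inl_inr, divV_symVhSAt_inl_inr hL, legInd_inr, legInd_inl]
  · rw [mfNeg_inr_inl, divV_symVhSAt_inr_inl hL, legInd_inl, legInd_inr]; ring
  · simp [divV_symVhSAt_inr_inr]

/-- [folklore] **(S-V)⁰⁴, COMMUTATOR FORM — the (W2) SHAPE**:
`divV (symVhSAt ρ d L) u = conjV (mfNeg (linSym04At ρ L)) (diagK (legInd ρ u))`. -/
theorem divV_symVhSAt_eq_conjV {L : ℕ} (hL : 1 ≤ L) (ρ u : Fin (d + 1) → ℤ) :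
    divV (symVhSAt ρ d L) u = conjV (mfNeg (linSym04At ρ L)) (diagK (legInd ρ u)) := by
  funext x z a b
  rw [conjV_diagK_apply, divV_symVhSAt_apply hL]
  ring

/-- [folklore] The same with `conjV` expanded. -/
theorem divV_symVhSAt_eq_comm {L : ℕ} (hL : 1 ≤ L) (ρ u : Fin (d + 1) → ℤ) :
    divV (symVhSAt ρ d L) u
      = comp (mfNeg (linSym04At ρ L)) (diagK (legInd ρ u)) - comp (diagK (legInd ρ u)) (mfNeg (linSym04At ρ L)) := by
  rw [divV_symVhSAt_eq_conjV hL]; rfl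

/-- [folklore] **(V-d)⁰⁴ — the letter `hVd04` of the root END `RowD1JointEndSymWard.d1Drift_JsB12Sym_of_an1Shift_wardTables_reflLetters_D1Tel_D1Rep`
for the instance `tabs.V := symVhSAt (ctr (d+1) L) d L`**, in its exact binder shape (`d = 3` there): a THEOREM for `1 ≤ L`. -/
theorem divV_symVhSAt_eq_conjV_ctr {L : ℕ} (hL : 1 ≤ L) :
    ∀ u : Fin (d + 1) → ℤ,
      divV (symVhSAt (ctr (d + 1) L) d L) u = conjV (mfNeg (linSym04At (ctr (d + 1) L) L)) (diagK (legInd (ctr (d + 1) L) u)) :=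
  fun u => divV_symVhSAt_eq_conjV hL _ u

/-- [folklore] TRANSVERSALITY AWAY FROM THE ACTION SITES: if the varied site `u` is neither leg's action site, the divergence
entry vanishes. -/
theorem divV_symVhSAt_eq_zero {L : ℕ} (hL : 1 ≤ L) {ρ u x z : Fin (d + 1) → ℤ} {a b : Fib d}
    (hz : legSite ρ z b ≠ u) (hx : legSite ρ x a ≠ u) : divV (symVhSAt ρ d L) u x z a b = 0 := by
  simp [divV_symVhSAt_apply hL, legInd_apply, hz, hx]

end

end Summit.QuantumFields.BalabanUV.Beta.SymAveragingWardRootedStencils
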